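import Literature.NumberTheory.LFunctions.GaussianRayHeckeL
import Literature.NumberTheory.LFunctions.GaussianPrimaryHeckeLSeries
import Literature.NumberTheory.LFunctions.TwistedZeroFreeRegion
import Literature.NumberTheory.LFunctions.GaussianHeckeNonvanishing
import HarnessLib

/-!
# Zero-free-region inputs for the Hecke `L`-functions of `ℚ(i)` modulo `M`: Euler product, odd-ideal zeta, `3-4-1`

Topic `Literature/NumberTheory/LFunctions`, sequel to `GaussianRayHeckeL.lean` (`heckeL M χ k`, the
continued `L(s, ψ)`, `ψ(z) = χ(z)(z/|z|)^k`) and `GaussianPrimaryHeckeLSeries.lean` (primary von Mangoldt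
calculus, `dSeries ψ = ψ(1) e^{qSeries ψ}`). Everything is PROVED; no named facts.

J. Friedlander, H. Iwaniec, Ann. of Math. 148 (1998), §16, after (16.19): "We also need a zero-free
region for `L(s, ψ)`. It follows from the above bounds by classical arguments that there are no zeros
for `s = σ + it` with (16.20) `σ > 1 - c/log(4d + |m| + |t|)` … apart from a possible exceptional
simple real zero in the case that `ψ` is real." The classical argument is Montgomery–Vaughan §11.1,
axiomatised in the tree as `TwistedZFRData` (`TwistedZeroFreeRegion.lean`); this file supplies its
ARITHMETIC fields for `F = L(s, ψ)`:

* `psi M χ k` — the weight `χ(z mod M)(z/|z|)^k` on `ℤ[i]` (`isPrimaryMul_psi`, `norm_psi_le_one`,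
  `psi_one`, `psi_zero_or_norm_one`); **`LSeriesHasSum_cCoeffP_psi` / `heckeL_eq_dSeries`** — for
  `4 ∣ M`, `Re s > 1`: `L(c_ψ, s) = heckeL M χ k s` (regrouping `hasSum_heckeL'` by norms), hence
  (field `ne_zero`) **`heckeL_ne_zero`** and (field `logDeriv_eq`) **`deriv_heckeL_div`**:
  `L'/L(s, ψ) = -P_ψ(s) = -L(l_ψ, s)`;
* the trivial weight `psi0` and **`Lam0`** — the von Mangoldt function of the ODD ideals of `ℤ[i]`
  (`Λ₀ ≥ 0`, `Λ₀(1) = 0`, summable for `σ > 1`, `LSeries_Lam0_eq`), the majorants (fields `norm_le₁`,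
  `norm_le₂`) `norm_lCoeffP_le_Lam0 : ‖l_ψ(n)‖ ≤ Λ₀(n)` and `norm_qSeries_le`;
* **`zetaOddE`** — the entire function `(s - 1) ζ_K^{odd}(s) = ∑_{c mod 4 primary} E_c(s)` (two primary
  classes mod `4`: `card_primary_classes_four`), `zetaOddE_eq` (`= (s-1) heckeL 4 1 0 s` off `{0,1}`),
  **`zetaOddE_one : Z(1) = π/8`**, `zetaOddE_ne_zero`, `logDeriv_zetaOddE`
  (`Z'/Z = 1/(s-1) - L(Λ₀, s)`), `norm_zetaOddE_le`; hence
  **`classicalZFRData_zetaOddE : ClassicalZFRData Lam0 zetaOddE 1`** and (field `re_LSeries₀_le`)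
  `exists_re_LSeries_Lam0_le : Re L(Λ₀, σ) ≤ 1/(σ-1) + K₀`;
* (towards field `lower`) **`norm_heckeL_ge_inv`**: `‖L(s, ψ)‖ ≥ ‖L(σ, 1 mod 4)‖⁻¹` for `σ = Re s > 1`
  (`‖L‖ = e^{Re Q_ψ} ≥ e^{-Q₀(σ)}`);
* (field `three_four_one`) `psiSq` (`psiSq_psi : ψ² = psi M χ² (2k)`), `re_term_341_nonneg`,
  **`three_four_one`**: `3 Re L(Λ₀,σ) + 4 Re L(l_ψ, σ+it) + Re L(l_{ψ²}, σ+2it) ≥ 0` for `σ > 1`.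

## References

* J. Friedlander, H. Iwaniec, Ann. of Math. (2) 148 (1998), 945–1040, §16 (16.16)–(16.20).
  [FriedlanderIwaniecAnnals1998]
* H. L. Montgomery, R. C. Vaughan, *Multiplicative Number Theory I*, CUP 2007, §6.1 Lemma 6.5,
  Theorem 6.7; §11.1. [MontgomeryVaughan2007]

## Mathlib / tree

Tree: `GaussianCosetTheta.{heckeL, hasSum_heckeL', differentiableAt_heckeL, cosetZetaE, cosetZetaE_eq,
cosetZetaE_one, differentiable_cosetZetaE, cosetL_zero_eq, norm_sum_cosetZetaE_le, classRep}`
(`GaussianRayHeckeL`); `GaussianPrimaryVM.{cCoeffP, lCoeffP, qCoeffP, dSeries, pSeries, qSeries,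
IsPrimaryMul, dSeries_ne_zero, pSeries_eq_neg_deriv_div, norm_dSeries_eq, LSeriesSummable_lCoeffP,
LSeriesSummable_qCoeffP, primesP, pairsNormP}` (`GaussianPrimaryHeckeLSeries`);
`ClassicalZFRData`, `ClassicalZFRData.exists_bound_LSeries` (`ClassicalZeroFreeRegion`);
`TwistedZFR.norm_LSeries_le_of_norm_le` (`TwistedZeroFreeRegion`); `GaussianHecke.{norm_fiber_eq,
halfPlane_mem_nhds, two_le_norm_of_prime, natAbs_norm_cast, normSum_pos}`; `FriedlanderIwaniecPrimes.
{GaussQuot, toQuot, isUnit_toQuot_of_coprime, norm_mulChar_apply_units, norm_mulChar_apply_le_one}`.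
Mathlib: `HasSum.tsum_fiberwise`, `Finset.tsum_subtype'`, `LSeries_congr`, `Complex.re_tsum`,
`MulChar.one_apply_coe`, `MulChar.pow_apply'`.
-/

noncomputable section

open Complex Real Filter Topology Asymptotics Set MeasureTheory Finset
open scoped Nat

namespace Literature.NumberTheory.LFunctions

namespace GaussianCosetTheta

local notation "ℤ[i]" => GaussianInt

variable {M : ℕ} [NeZero M]


open Literature.NumberTheory.QuadraticFields.GaussianPrimary (IsPrimary isPrimary_iff_dvd primaryNormEq mem_primaryNormEq)
open Literature.NumberTheory.Sieve.FriedlanderIwaniecPrimes (GaussQuot toQuot toQuot_eq_toQuot_iff isUnit_toQuot_of_coprime)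
open GaussianPrimaryVM LSeries

/-! ### The weight `ψ = χ · (z/|z|)^k` and the bridge `L(c_ψ, s) = heckeL` -/

variable (M) in
/-- FI's Hecke character as a function on `ℤ[i]`: `ψ(z) = χ(z mod M) · (z/|z|)^k` (used on primary
`z`; `χ` vanishes on classes not prime to `M`). [cite: FriedlanderIwaniecAnnals1998, (16.16)] -/
def psi (χ : MulChar (GaussQuot M) ℂ) (k : ℕ) (z : ℤ[i]) : ℂ :=
  χ (toQuot M z) * ((z : ℂ) / (‖(z : ℂ)‖ : ℂ)) ^ k

/-- The angular factor is multiplicative: `(zw/|zw|)^k = (z/|z|)^k (w/|w|)^k`. [folklore] -/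
theorem angular_mul (z w : ℤ[i]) (k : ℕ) :
    (((z * w : ℤ[i]) : ℂ) / (‖((z * w : ℤ[i]) : ℂ)‖ : ℂ)) ^ k =
      ((z : ℂ) / (‖(z : ℂ)‖ : ℂ)) ^ k * ((w : ℂ) / (‖(w : ℂ)‖ : ℂ)) ^ k := by
  rw [← mul_pow, map_mul, norm_mul]
  push_cast
  rw [mul_div_mul_comm]

/-- `|(z/|z|)^k| ≤ 1`. [folklore] -/
theorem norm_angular_le_one (z : ℤ[i]) (k : ℕ) : ‖((z : ℂ) / (‖(z : ℂ)‖ : ℂ)) ^ k‖ ≤ 1 := by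
  rw [norm_pow]
  refine pow_le_one₀ (norm_nonneg _) ?_
  rw [norm_div, Complex.norm_real, Real.norm_eq_abs, abs_norm]
  exact div_self_le_one _

/-- `|(z/|z|)^k| = 1` for `z ≠ 0`. [folklore] -/
theorem norm_angular_eq_one {z : ℤ[i]} (hz : z ≠ 0) (k : ℕ) : ‖((z : ℂ) / (‖(z : ℂ)‖ : ℂ)) ^ k‖ = 1 := by
  have h : ‖(z : ℂ)‖ ≠ 0 := by
    rw [norm_ne_zero_iff, Ne, GaussianInt.toComplex_eq_zero]; exact hz
  rw [norm_pow, norm_div, Complex.norm_real, Real.norm_eq_abs, abs_norm, div_self h, one_pow]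

omit [NeZero M] in
/-- `ψ` is multiplicative on primary elements (indeed on all of `ℤ[i]`). [folklore] -/
theorem isPrimaryMul_psi (χ : MulChar (GaussQuot M) ℂ) (k : ℕ) : IsPrimaryMul (psi M χ k) := by
  intro x y _ _
  rw [psi, psi, psi, map_mul, map_mul, angular_mul]
  ring

/-- `|ψ| ≤ 1`. [folklore] -/
theorem norm_psi_le_one (χ : MulChar (GaussQuot M) ℂ) (k : ℕ) (z : ℤ[i]) : ‖psi M χ k z‖ ≤ 1 := by
  rw [psi, norm_mul]
  calc ‖χ (toQuot M z)‖ * ‖((z : ℂ) / (‖(z : ℂ)‖ : ℂ)) ^ k‖ ≤ 1 * 1 :=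
        mul_le_mul (norm_mulChar_le_one χ _) (norm_angular_le_one z k) (norm_nonneg _) zero_le_one
    _ = 1 := one_mul 1

omit [NeZero M] in
/-- `ψ(1) = 1`. [folklore] -/
theorem psi_one (χ : MulChar (GaussQuot M) ℂ) (k : ℕ) : psi M χ k 1 = 1 := by
  rw [psi, map_one, map_one]
  simp

/-- On a primary `z` either `ψ(z) = 0` or `|ψ(z)| = 1` (`χ(z)` is `0` or unimodular). [folklore] -/
theorem psi_zero_or_norm_one (χ : MulChar (GaussQuot M) ℂ) (k : ℕ) {z : ℤ[i]} (hz : z ≠ 0) :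
    psi M χ k z = 0 ∨ ‖psi M χ k z‖ = 1 := by
  by_cases hu : IsUnit (toQuot M z)
  · right
    obtain ⟨u, hu⟩ := hu
    rw [psi, norm_mul, ← hu, Literature.NumberTheory.Sieve.FriedlanderIwaniecPrimes.norm_mulChar_apply_units,
      norm_angular_eq_one hz, one_mul]
  · left
    rw [psi, χ.map_nonunit hu, zero_mul]

/-- **`L(c_ψ, s) = L(s, ψ)`**: for `4 ∣ M` and `Re s > 1`, the `L`-series of the coefficients
`c_ψ(n) = ∑_{z ∈ primaryNormEq n} ψ(z)` has sum `heckeL M χ k s` (regroup `hasSum_heckeL'` by norms).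
[cite: FriedlanderIwaniecAnnals1998, (16.17), (16.30)] -/
theorem LSeriesHasSum_cCoeffP_psi (h4 : 4 ∣ M) (χ : MulChar (GaussQuot M) ℂ) (k : ℕ) {s : ℂ} (hs : 1 < s.re) :
    LSeriesHasSum (cCoeffP (psi M χ k)) s (heckeL M χ k s) := by
  set f : ℤ[i] → ℂ := fun z ↦ if IsPrimary z then
      χ (toQuot M z) * ((z : ℂ) / (‖(z : ℂ)‖ : ℂ)) ^ k / (((z.norm : ℝ)) : ℂ) ^ s else 0 with hf
  have h := (hasSum_heckeL' h4 χ k hs).tsum_fiberwise fun x : ℤ[i] ↦ x.norm.natAbs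
  refine h.congr_fun fun n ↦ ?_
  show term (cCoeffP (psi M χ k)) s n = ∑' x : ↑((fun x : ℤ[i] ↦ x.norm.natAbs) ⁻¹' {n}), f x
  rw [tsum_congr_set_coe f (GaussianHecke.norm_fiber_eq n), Finset.tsum_subtype' (GaussianTheta.normEq n) f]
  -- both sides as sums over `normEq n`
  rcases eq_or_ne n 0 with rfl | hn
  · rw [term_zero, GaussianTheta.normEq_zero, sum_singleton, hf]
    simp only
    rw [if_neg]
    decide
  · rw [term_of_ne_zero hn, cCoeffP, ← filter_isPrimary_normEq, sum_filter, sum_div]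
    refine sum_congr rfl fun x hx ↦ ?_
    rw [GaussianTheta.mem_normEq] at hx
    simp only [hf, psi]
    split_ifs with hp
    · rw [hx]; push_cast; ring
    · rw [zero_div]

/-- **`L(s, ψ) = D_ψ(s)`** (`dSeries`) for `Re s > 1`. [cite: FriedlanderIwaniecAnnals1998, (16.17)] -/
theorem heckeL_eq_dSeries (h4 : 4 ∣ M) (χ : MulChar (GaussQuot M) ℂ) (k : ℕ) {s : ℂ} (hs : 1 < s.re) :
    heckeL M χ k s = dSeries (psi M χ k) s :=
  ((LSeriesHasSum_cCoeffP_psi h4 χ k hs).LSeries_eq).symm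

/-- **`L(s, ψ) ≠ 0` for `Re s > 1`.** [cite: FriedlanderIwaniecAnnals1998, (16.17)] -/
theorem heckeL_ne_zero (h4 : 4 ∣ M) (χ : MulChar (GaussQuot M) ℂ) (k : ℕ) {s : ℂ} (hs : 1 < s.re) :
    heckeL M χ k s ≠ 0 := by
  rw [heckeL_eq_dSeries h4 χ k hs]
  exact dSeries_ne_zero (isPrimaryMul_psi χ k) (fun z _ ↦ norm_psi_le_one χ k z)
    (by rw [psi_one]; exact one_ne_zero) hs

/-- **`L'/L(s, ψ) = -P_ψ(s)`** for `Re s > 1` (the derivative of `heckeL` itself). [folklore] -/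
theorem deriv_heckeL_div (h4 : 4 ∣ M) (χ : MulChar (GaussQuot M) ℂ) (k : ℕ) {s : ℂ} (hs : 1 < s.re) :
    deriv (heckeL M χ k) s / heckeL M χ k s = -pSeries (psi M χ k) s := by
  have hev : heckeL M χ k =ᶠ[𝓝 s] dSeries (psi M χ k) := by
    filter_upwards [GaussianHecke.halfPlane_mem_nhds hs] with z hz
    exact heckeL_eq_dSeries h4 χ k hz
  rw [hev.deriv_eq, heckeL_eq_dSeries h4 χ k hs,
    pSeries_eq_neg_deriv_div (isPrimaryMul_psi χ k) (fun z _ ↦ norm_psi_le_one χ k z)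
      (by rw [psi_one]; exact one_ne_zero) hs]
  ring

/-! ### Changing the weight on non-primary elements -/

/-- `c_ψ` only sees primary elements. [folklore] -/
theorem cCoeffP_congr {ψ ψ' : ℤ[i] → ℂ} (h : ∀ z, IsPrimary z → ψ z = ψ' z) : cCoeffP ψ = cCoeffP ψ' := by
  funext n
  exact sum_congr rfl fun x hx ↦ h x (mem_primaryNormEq.mp hx).2

/-- `l_ψ` only sees primary primes. [folklore] -/
theorem lCoeffP_congr {ψ ψ' : ℤ[i] → ℂ} (h : ∀ z, IsPrimary z → ψ z = ψ' z) : lCoeffP ψ = lCoeffP ψ' := by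
  funext n
  refine sum_congr rfl fun p hp ↦ ?_
  rw [h p.1 (mem_primesP.mp (mem_pairsNormP.mp hp).1).2.1]

/-- `q_ψ` only sees primary primes. [folklore] -/
theorem qCoeffP_congr {ψ ψ' : ℤ[i] → ℂ} (h : ∀ z, IsPrimary z → ψ z = ψ' z) : qCoeffP ψ = qCoeffP ψ' := by
  funext n
  refine sum_congr rfl fun p hp ↦ ?_
  rw [h p.1 (mem_primesP.mp (mem_pairsNormP.mp hp).1).2.1]

/-! ### The trivial weight: `Λ₀` and `q₀` -/

/-- The trivial weight `ψ₀ ≡ 1` (the odd-ideal zeta function `ζ_K^{odd}(s) = ∑_{z primary} N(z)^{-s}`).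
[folklore] -/
def psi0 : ℤ[i] → ℂ := fun _ ↦ 1

/-- `ψ₀` is multiplicative. [folklore] -/
theorem isPrimaryMul_psi0 : IsPrimaryMul psi0 := fun _ _ _ _ ↦ by simp [psi0]

/-- `|ψ₀| ≤ 1`. [folklore] -/
theorem norm_psi0_le (z : ℤ[i]) : ‖psi0 z‖ ≤ 1 := by simp [psi0]

/-- `Λ₀(n) = ∑_{(π, j) : N(π)^j = n} log N(π)` — the von Mangoldt function of the odd ideals of `ℤ[i]`,
real and non-negative; `(Λ₀ n : ℂ) = l_{ψ₀}(n)`. [folklore] -/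
def Lam0 (n : ℕ) : ℝ := ∑ p ∈ pairsNormP n, Real.log (p.1.norm : ℝ)

/-- `(Λ₀ n : ℂ) = l_{ψ₀}(n)`. [folklore] -/
theorem Lam0_cast (n : ℕ) : ((Lam0 n : ℝ) : ℂ) = lCoeffP psi0 n := by
  rw [Lam0, lCoeffP, Complex.ofReal_sum]
  refine sum_congr rfl fun p _ ↦ ?_
  simp [psi0]

/-- `Λ₀ ≥ 0`. [folklore] -/
theorem Lam0_nonneg (n : ℕ) : 0 ≤ Lam0 n := by
  refine sum_nonneg fun p hp ↦ Real.log_nonneg ?_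
  have := GaussianHecke.two_le_norm_of_prime (mem_primesP.mp (mem_pairsNormP.mp hp).1).1
  have h1 : (1 : ℤ) ≤ p.1.norm := by omega
  exact_mod_cast h1

/-- `pairsNormP 1 = ∅` (no prime power has norm `1`). [folklore] -/
theorem pairsNormP_one : pairsNormP 1 = ∅ := by
  refine Finset.eq_empty_of_forall_notMem fun p hp ↦ ?_
  obtain ⟨hπ, hj, hN⟩ := mem_pairsNormP.mp hp
  have h2 : 2 ≤ p.1.norm.natAbs := by
    have := GaussianHecke.two_le_norm_of_prime (mem_primesP.mp hπ).1
    have := GaussianHecke.natAbs_norm_cast p.1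
    omega
  have : 2 ≤ p.1.norm.natAbs ^ p.2 :=
    h2.trans (Nat.le_self_pow (by have := (mem_Icc.mp hj).1; omega) _)
  omega

/-- `Λ₀(1) = 0`. [folklore] -/
theorem Lam0_one : Lam0 1 = 0 := by
  rw [Lam0, pairsNormP_one, sum_empty]

/-- `∑ Λ₀(n) n^{-s}` converges absolutely for `σ > 1`. [folklore] -/
theorem LSeriesSummable_Lam0 {s : ℂ} (hs : 1 < s.re) : LSeriesSummable (fun n ↦ ((Lam0 n : ℝ) : ℂ)) s := by
  have h := LSeriesSummable_lCoeffP (ψ := psi0) (fun z _ ↦ norm_psi0_le z) hs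
  exact (LSeriesSummable_congr s (fun {n} _ ↦ Lam0_cast n)).mpr h

/-- `L(Λ₀, s) = P_{ψ₀}(s)`. [folklore] -/
theorem LSeries_Lam0_eq (s : ℂ) : LSeries (fun n ↦ ((Lam0 n : ℝ) : ℂ)) s = pSeries psi0 s := by
  rw [pSeries]
  exact LSeries_congr (fun {n} _ ↦ Lam0_cast n) s

/-- **`|l_ψ(n)| ≤ Λ₀(n)`** for `|ψ| ≤ 1` on primary elements (the field `norm_le₁` of the ZFR datum).
[folklore] -/
theorem norm_lCoeffP_le_Lam0 {ψ : ℤ[i] → ℂ} (hbd : ∀ z, IsPrimary z → ‖ψ z‖ ≤ 1) (n : ℕ) :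
    ‖lCoeffP ψ n‖ ≤ Lam0 n := by
  rw [lCoeffP, Lam0]
  refine (norm_sum_le _ _).trans (sum_le_sum fun p hp ↦ ?_)
  have hQ := (mem_primesP.mp (mem_pairsNormP.mp hp).1).2.1
  have hN1 : (1 : ℝ) ≤ (p.1.norm : ℝ) := by
    have := GaussianHecke.two_le_norm_of_prime (mem_primesP.mp (mem_pairsNormP.mp hp).1).1
    have h1 : (1 : ℤ) ≤ p.1.norm := by omega
    exact_mod_cast h1
  rw [norm_mul, Complex.norm_real, Real.norm_of_nonneg (Real.log_nonneg hN1), norm_pow]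
  calc Real.log (p.1.norm : ℝ) * ‖ψ p.1‖ ^ p.2 ≤ Real.log (p.1.norm : ℝ) * 1 :=
        mul_le_mul_of_nonneg_left (pow_le_one₀ (norm_nonneg _) (hbd _ hQ)) (Real.log_nonneg hN1)
    _ = Real.log (p.1.norm : ℝ) := mul_one _

/-- `q₀(n) = ∑_{(π,j)} j⁻¹` is real and non-negative: `(q₀ n).re = ‖q₀ n‖` form. [folklore] -/
theorem qCoeffP_psi0_eq (n : ℕ) : qCoeffP psi0 n = ((∑ p ∈ pairsNormP n, (p.2 : ℝ)⁻¹ : ℝ) : ℂ) := by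
  rw [qCoeffP, Complex.ofReal_sum]
  refine sum_congr rfl fun p _ ↦ ?_
  simp [psi0]

/-- **`|q_ψ(n)| ≤ q₀(n)`** termwise, for `|ψ| ≤ 1` on primary elements. [folklore] -/
theorem norm_qCoeffP_le_q0 {ψ : ℤ[i] → ℂ} (hbd : ∀ z, IsPrimary z → ‖ψ z‖ ≤ 1) (n : ℕ) :
    ‖qCoeffP ψ n‖ ≤ ∑ p ∈ pairsNormP n, (p.2 : ℝ)⁻¹ := by
  rw [qCoeffP]
  refine (norm_sum_le _ _).trans (sum_le_sum fun p hp ↦ ?_)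
  have hQ := (mem_primesP.mp (mem_pairsNormP.mp hp).1).2.1
  rw [norm_div, Complex.norm_natCast, norm_pow]
  have hj0 : (0 : ℝ) < p.2 := by exact_mod_cast (mem_Icc.mp (mem_pairsNormP.mp hp).2.1).1
  rw [div_le_iff₀ hj0, inv_mul_cancel₀ hj0.ne']
  exact pow_le_one₀ (norm_nonneg _) (hbd _ hQ)

/-- `‖Q_ψ(s)‖ ≤ Q_{ψ₀}(σ)` (real part) for `σ = Re s > 1`. [folklore] -/
theorem norm_qSeries_le {ψ : ℤ[i] → ℂ} (hbd : ∀ z, IsPrimary z → ‖ψ z‖ ≤ 1) {s : ℂ} (hs : 1 < s.re) :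
    ‖qSeries ψ s‖ ≤ (qSeries psi0 (s.re : ℂ)).re := by
  set q0 : ℕ → ℝ := fun n ↦ ∑ p ∈ pairsNormP n, (p.2 : ℝ)⁻¹ with hq0def
  have hq0 : (fun n ↦ ((q0 n : ℝ) : ℂ)) = qCoeffP psi0 := by
    funext n
    exact (qCoeffP_psi0_eq n).symm
  have hsum : ∀ s : ℂ, 1 < s.re → LSeriesSummable (fun n ↦ ((q0 n : ℝ) : ℂ)) s := by
    intro s hs
    rw [hq0]
    exact LSeriesSummable_qCoeffP (ψ := psi0) (fun z _ ↦ norm_psi0_le z) hs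
  have h := TwistedZFR.norm_LSeries_le_of_norm_le (Λ₀ := q0) (f := qCoeffP ψ) (norm_qCoeffP_le_q0 hbd)
    hsum hs le_rfl
  rw [hq0] at h
  exact h

/-! ### The odd-ideal zeta function `ζ_K^{odd}` as a `ClassicalZFRData` -/

/-- **`Z(s) = (s - 1) ζ_K^{odd}(s)`**, entire: `∑_{c mod 4 primary} E_c(s)` (`E_c = (s - 1) Z_0(·; c, 4)`,
`cosetZetaE`). [folklore] -/
def zetaOddE (s : ℂ) : ℂ :=
  ∑ cl : ZMod 4 × ZMod 4, if IsPrimary (classRep 4 cl) then cosetZetaE 4 (classRep 4 cl) s else 0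

/-- `Z` is entire. [folklore] -/
theorem differentiable_zetaOddE : Differentiable ℂ zetaOddE := by
  have h : zetaOddE = fun s ↦ ∑ cl : ZMod 4 × ZMod 4,
      (if IsPrimary (classRep 4 cl) then cosetZetaE 4 (classRep 4 cl) s else 0) := rfl
  rw [h]
  refine Differentiable.fun_sum fun cl _ ↦ ?_
  by_cases hp : IsPrimary (classRep 4 cl)
  · simp only [if_pos hp]; exact differentiable_cosetZetaE
  · simp only [if_neg hp]; exact differentiable_const 0

/-- The trivial character takes the value `1` on primary classes modulo `4`. [folklore] -/
theorem one_apply_toQuot_of_isPrimary {c : ℤ[i]} (hc : IsPrimary c) : (1 : MulChar (GaussQuot 4) ℂ) (toQuot 4 c) = 1 := by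
  have hodd : c.norm % 2 = 1 := hc.norm_odd
  have hcop : Nat.Coprime c.norm.natAbs 4 := by
    have h2 : Nat.Coprime c.norm.natAbs 2 := by
      rw [Nat.coprime_two_right, Nat.odd_iff]
      have := GaussianHecke.natAbs_norm_cast c
      omega
    simpa using Nat.Coprime.pow_right 2 h2
  obtain ⟨u, hu⟩ := isUnit_toQuot_of_coprime hcop
  rw [← hu, MulChar.one_apply_coe]

/-- `Z(s) = (s - 1) L(s, 1)` (`heckeL 4 1 0`) for `s ≠ 0, 1`. [folklore] -/
theorem zetaOddE_eq {s : ℂ} (hs0 : s ≠ 0) (hs1 : s ≠ 1) : zetaOddE s = (s - 1) * heckeL 4 1 0 s := by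
  rw [zetaOddE, heckeL, mul_sum]
  refine sum_congr rfl fun cl _ ↦ ?_
  by_cases hp : IsPrimary (classRep 4 cl)
  · rw [if_pos hp, if_pos hp, one_apply_toQuot_of_isPrimary hp, one_mul, cosetL_zero_eq, cosetZetaE_eq hs0 hs1]
  · rw [if_neg hp, if_neg hp, mul_zero]

/-- `L(s, 1 mod 4) = D_{ψ₀}(s)` for `Re s > 1`. [folklore] -/
theorem heckeL_four_one_eq (s : ℂ) (hs : 1 < s.re) : heckeL 4 1 0 s = dSeries psi0 s := by
  rw [heckeL_eq_dSeries (dvd_refl 4) 1 0 hs, dSeries, dSeries,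
    cCoeffP_congr (ψ := psi 4 1 0) (ψ' := psi0) (fun z hz ↦ ?_)]
  rw [psi, psi0, one_apply_toQuot_of_isPrimary hz, pow_zero, mul_one]

/-- There are exactly two primary classes modulo `4ℤ[i]` (`1` and `3 + 2i`). [folklore] -/
theorem card_primary_classes_four :
    (Finset.univ.filter fun cl : ZMod 4 × ZMod 4 ↦ IsPrimary (classRep 4 cl)).card = 2 := by
  decide

/-- **`Z(1) = π/8`** (`= 2 · π/4²`: two primary classes, residue `π/M²` each). [folklore] -/
theorem zetaOddE_one : zetaOddE 1 = π / 8 := by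
  rw [zetaOddE]
  have h : ∀ cl : ZMod 4 × ZMod 4, (if IsPrimary (classRep 4 cl) then cosetZetaE 4 (classRep 4 cl) 1 else 0) =
      if IsPrimary (classRep 4 cl) then (π / (4 : ℂ) ^ 2 : ℂ) else 0 := by
    intro cl
    split_ifs with hp
    · rw [cosetZetaE_one]; norm_num
    · rfl
  rw [sum_congr rfl fun cl _ ↦ h cl, ← sum_filter, sum_const, card_primary_classes_four, nsmul_eq_mul]
  push_cast
  ring

/-- `Z(1) ≠ 0`. [folklore] -/
theorem zetaOddE_one_ne : zetaOddE 1 ≠ 0 := by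
  rw [zetaOddE_one]; exact div_ne_zero (ofReal_ne_zero.mpr Real.pi_ne_zero) (by norm_num)

/-- `Z(s) ≠ 0` for `Re s > 1`. [folklore] -/
theorem zetaOddE_ne_zero {s : ℂ} (hs : 1 < s.re) : zetaOddE s ≠ 0 := by
  have hs0 : s ≠ 0 := fun h ↦ by rw [h, zero_re] at hs; linarith
  have hs1 : s ≠ 1 := fun h ↦ by rw [h, one_re] at hs; linarith
  rw [zetaOddE_eq hs0 hs1]
  exact mul_ne_zero (sub_ne_zero.mpr hs1) (heckeL_ne_zero (dvd_refl 4) 1 0 hs)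

/-- `Z'/Z(s) = 1/(s - 1) - L(Λ₀, s)` for `Re s > 1`. [folklore] -/
theorem logDeriv_zetaOddE {s : ℂ} (hs : 1 < s.re) :
    deriv zetaOddE s / zetaOddE s = 1 / (s - 1) - LSeries (fun n ↦ ((Lam0 n : ℝ) : ℂ)) s := by
  have hs0 : s ≠ 0 := fun h ↦ by rw [h, zero_re] at hs; linarith
  have hs1 : s ≠ 1 := fun h ↦ by rw [h, one_re] at hs; linarith
  have h1s : s - 1 ≠ 0 := sub_ne_zero.mpr hs1
  have hD := heckeL_ne_zero (dvd_refl 4) (1 : MulChar (GaussQuot 4) ℂ) 0 hs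
  have hev : zetaOddE =ᶠ[𝓝 s] fun z ↦ (z - 1) * heckeL 4 1 0 z := by
    filter_upwards [GaussianHecke.halfPlane_mem_nhds hs] with z hz
    have hz0 : z ≠ 0 := fun h ↦ by rw [h, zero_re] at hz; exact absurd hz (by norm_num)
    have hz1 : z ≠ 1 := fun h ↦ by rw [h, one_re] at hz; exact absurd hz (by norm_num)
    exact zetaOddE_eq hz0 hz1
  have hdiff : DifferentiableAt ℂ (heckeL 4 1 0) s := differentiableAt_heckeL 1 0 hs0 hs1
  have hderiv : deriv zetaOddE s = heckeL 4 1 0 s + (s - 1) * deriv (heckeL 4 1 0) s := by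
    rw [hev.deriv_eq]
    have hfun : (fun z : ℂ ↦ (z - 1) * heckeL 4 1 0 z) = (fun x : ℂ ↦ id x - 1) * heckeL 4 1 0 := by
      funext z; simp
    have := ((hasDerivAt_id s).sub_const 1).mul hdiff.hasDerivAt
    rw [hfun, this.deriv]; simp
  have hp : pSeries psi0 s = pSeries (psi 4 1 0) s := by
    rw [pSeries, pSeries, lCoeffP_congr (ψ := psi0) (ψ' := psi 4 1 0) (fun z hz ↦ ?_)]
    rw [psi, psi0, one_apply_toQuot_of_isPrimary hz, pow_zero, mul_one]
  have hlog := deriv_heckeL_div (dvd_refl 4) (1 : MulChar (GaussQuot 4) ℂ) 0 hs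
  rw [hderiv, zetaOddE_eq hs0 hs1, LSeries_Lam0_eq, hp, ← neg_neg (pSeries (psi 4 1 0) s), ← hlog]
  field_simp
  ring

/-- Growth of `Z`: `‖Z(s)‖ ≤ 16 · 4³ normSum(3/2) ‖2 + s‖³` for `Re s ≥ -1/2`. [folklore] -/
theorem norm_zetaOddE_le {s : ℂ} (hs : -1 / 2 ≤ s.re) :
    ‖zetaOddE s‖ ≤ ((4 : ℝ) ^ 3 * ∑' x : ℤ[i], ((x.norm : ℤ) : ℝ) ^ (-(3 / 2 : ℝ))) * ‖(2 : ℂ) + s‖ ^ 3 := by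
  have h := norm_sum_cosetZetaE_le (M := 4) (1 : MulChar (GaussQuot 4) ℂ) hs
  have heq : zetaOddE s = ∑ cl : ZMod 4 × ZMod 4, (if IsPrimary (classRep 4 cl) then
      (1 : MulChar (GaussQuot 4) ℂ) (toQuot 4 (classRep 4 cl)) * cosetZetaE 4 (classRep 4 cl) s else 0) := by
    rw [zetaOddE]
    refine sum_congr rfl fun cl _ ↦ ?_
    split_ifs with hp
    · rw [one_apply_toQuot_of_isPrimary hp, one_mul]
    · rfl
  rw [heq]
  convert h using 2
  norm_num

/-- **The odd-ideal zeta function of `ℤ[i]` as a `ClassicalZFRData`** (`Λ = Λ₀`, `G = Z`, `η = 1`):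
the input of the de la Vallée-Poussin–Landau machinery (`re_LSeries₀_le`, pole-case bound).
[cite: MontgomeryVaughan2007, §6.1 and p. 267] -/
theorem classicalZFRData_zetaOddE : ClassicalZFRData Lam0 zetaOddE 1 where
  eta_pos := one_pos
  eta_le_one := le_rfl
  nonneg := Lam0_nonneg
  map_one := Lam0_one
  summable := fun s hs ↦ LSeriesSummable_Lam0 hs
  differentiableOn := differentiable_zetaOddE.differentiableOn
  ne_zero := fun s hs ↦ zetaOddE_ne_zero hs
  logDeriv_eq := fun s hs ↦ logDeriv_zetaOddE hs
  map_one_ne := zetaOddE_one_ne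
  growth := by
    refine ⟨3, (4 : ℝ) ^ 3 * (∑' x : ℤ[i], ((x.norm : ℤ) : ℝ) ^ (-(3 / 2 : ℝ))) * 2 ^ 3, by norm_num, fun s hs1 hs3 ↦ ?_⟩
    have hs' : -1 / 2 ≤ s.re := by linarith
    refine (norm_zetaOddE_le hs').trans ?_
    have hX : ‖(2 : ℂ) + s‖ ≤ 2 * (|s.im| + 4) := by
      refine (Complex.norm_le_abs_re_add_abs_im _).trans ?_
      have hre : |((2 : ℂ) + s).re| ≤ 5 := by simp [abs_le]; constructor <;> linarith
      have him : |((2 : ℂ) + s).im| = |s.im| := by simp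
      rw [him]; linarith [abs_nonneg s.im]
    have hnS := GaussianHecke.normSum_pos (show (1 : ℝ) < 3 / 2 by norm_num)
    calc ((4 : ℝ) ^ 3 * ∑' x : ℤ[i], ((x.norm : ℤ) : ℝ) ^ (-(3 / 2 : ℝ))) * ‖(2 : ℂ) + s‖ ^ 3
        ≤ ((4 : ℝ) ^ 3 * ∑' x : ℤ[i], ((x.norm : ℤ) : ℝ) ^ (-(3 / 2 : ℝ))) * (2 * (|s.im| + 4)) ^ 3 := by gcongr
      _ = (4 : ℝ) ^ 3 * (∑' x : ℤ[i], ((x.norm : ℤ) : ℝ) ^ (-(3 / 2 : ℝ))) * 2 ^ 3 * (|s.im| + 4) ^ (3 : ℝ) := by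
          rw [show ((3 : ℝ)) = ((3 : ℕ) : ℝ) by norm_num, Real.rpow_natCast]; ring

/-- **`Re L(Λ₀, σ) ≤ 1/(σ - 1) + K₀`** for `1 < σ ≤ 2` (field `re_LSeries₀_le` of the ZFR datum).
[cite: MontgomeryVaughan2007, Theorem 6.7] -/
theorem exists_re_LSeries_Lam0_le : ∃ K₀ : ℝ, 0 ≤ K₀ ∧ ∀ σ : ℝ, 1 < σ → σ ≤ 2 →
    (LSeries (fun n ↦ ((Lam0 n : ℝ) : ℂ)) σ).re ≤ 1 / (σ - 1) + K₀ := by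
  obtain ⟨K₁, hK₁, hK⟩ := classicalZFRData_zetaOddE.exists_bound_LSeries
  refine ⟨K₁, hK₁, fun σ hσ hσ2 ↦ ?_⟩
  have := (hK (σ : ℂ) (by simp [hσ]) (by simp [hσ2])).1
  simpa using this

/-! ### The lower bound `|L(s, ψ)| ≥ c₁ (σ - 1)` -/

/-- `exp(Q_{ψ₀}(σ)) = D_{ψ₀}(σ) = ‖L(σ, 1 mod 4)‖` for real `σ > 1`. [folklore] -/
theorem exp_qSeries_psi0_eq {σ : ℝ} (hσ : 1 < σ) : Real.exp (qSeries psi0 σ).re = ‖heckeL 4 1 0 σ‖ := by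
  rw [heckeL_four_one_eq σ (by simp [hσ]), norm_dSeries_eq isPrimaryMul_psi0 (fun z _ ↦ norm_psi0_le z) rfl (by simp [hσ])]

/-- **`‖L(s, ψ)‖ ≥ ‖L(σ, 1 mod 4)‖⁻¹`** for `σ = Re s > 1` (`|ψ| ≤ 1`, `ψ(1) = 1`, `4 ∣ M`):
`‖L(s,ψ)‖ = exp(Re Q_ψ(s)) ≥ exp(-Q₀(σ)) = 1/D₀(σ)`. [folklore] -/
theorem norm_heckeL_ge_inv (h4 : 4 ∣ M) (χ : MulChar (GaussQuot M) ℂ) (k : ℕ) {s : ℂ} (hs : 1 < s.re) :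
    ‖heckeL 4 1 0 (s.re : ℂ)‖⁻¹ ≤ ‖heckeL M χ k s‖ := by
  have hbd : ∀ z, IsPrimary z → ‖psi M χ k z‖ ≤ 1 := fun z _ ↦ norm_psi_le_one χ k z
  rw [heckeL_eq_dSeries h4 χ k hs, norm_dSeries_eq (isPrimaryMul_psi χ k) hbd (psi_one χ k) hs,
    ← exp_qSeries_psi0_eq hs, ← Real.exp_neg]
  apply Real.exp_le_exp.mpr
  have h1 := norm_qSeries_le hbd hs
  have h2 := Complex.abs_re_le_norm (qSeries (psi M χ k) s)
  linarith [neg_abs_le (qSeries (psi M χ k) s).re]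

/-! ### The `3-4-1` inequality for `Λ₀`, `l_ψ`, `l_{ψ²}` -/

/-- The pointwise square of the weight (model: `ψ² = χ² (z/|z|)^{2k}`). [folklore] -/
def psiSq (ψ : ℤ[i] → ℂ) : ℤ[i] → ℂ := fun z ↦ ψ z ^ 2

omit [NeZero M] in
/-- `psi²` for FI's weight is FI's weight for `χ²`, `2k`. [folklore] -/
theorem psiSq_psi (χ : MulChar (GaussQuot M) ℂ) (k : ℕ) : psiSq (psi M χ k) = psi M (χ ^ 2) (2 * k) := by
  funext z
  rw [psiSq, psi, psi, MulChar.pow_apply' _ two_ne_zero, mul_pow, ← pow_mul, mul_comm k 2]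

/-- The termwise `3-4-1`: for `n ≥ 1`, real `σ`, `t`,
`Re(3 Λ₀(n) n^{-σ} + 4 l_ψ(n) n^{-σ-it} + l_{ψ²}(n) n^{-σ-2it}) ≥ 0` when `ψ(π)` is `0` or unimodular
on primary primes. [cite: MontgomeryVaughan2007, Lemma 6.5] -/
theorem re_term_341_nonneg {ψ : ℤ[i] → ℂ} (hun : ∀ z, IsPrimary z → ψ z = 0 ∨ ‖ψ z‖ = 1) (σ t : ℝ) (n : ℕ) :
    0 ≤ (3 * term (fun n ↦ ((Lam0 n : ℝ) : ℂ)) σ n + 4 * term (lCoeffP ψ) (σ + t * I) n +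
      term (lCoeffP (psiSq ψ)) (σ + 2 * t * I) n).re := by
  rcases eq_or_ne n 0 with rfl | hn
  · simp
  have hn0 : (n : ℂ) ≠ 0 := Nat.cast_ne_zero.mpr hn
  set u : ℂ := (n : ℂ) ^ (-(t * I)) with hu
  have hnu : ‖u‖ = 1 := by
    rw [hu, Complex.norm_natCast_cpow_of_pos (Nat.pos_of_ne_zero hn)]; simp
  set r : ℝ := (n : ℝ) ^ σ with hr
  have hr0 : 0 < r := Real.rpow_pos_of_pos (Nat.cast_pos.mpr (Nat.pos_of_ne_zero hn)) σ
  have hnσ : (n : ℂ) ^ (σ : ℂ) = (r : ℂ) := by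
    rw [hr, Complex.ofReal_cpow (Nat.cast_nonneg n)]
    norm_cast
  have hrc : (r : ℂ) ≠ 0 := ofReal_ne_zero.mpr hr0.ne'
  have h1 : term (fun n ↦ ((Lam0 n : ℝ) : ℂ)) σ n = (r : ℂ)⁻¹ * lCoeffP psi0 n := by
    rw [term_of_ne_zero hn, hnσ, div_eq_inv_mul, Lam0_cast]
  have h2 : term (lCoeffP ψ) (σ + t * I) n = (r : ℂ)⁻¹ * (lCoeffP ψ n * u) := by
    rw [term_of_ne_zero hn, cpow_add _ _ hn0, hnσ, hu, cpow_neg]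
    field_simp
  have h3 : term (lCoeffP (psiSq ψ)) (σ + 2 * t * I) n = (r : ℂ)⁻¹ * (lCoeffP (psiSq ψ) n * u ^ 2) := by
    have hu2 : u ^ 2 = ((n : ℂ) ^ (2 * t * I))⁻¹ := by
      rw [hu, ← cpow_nat_mul, ← cpow_neg]
      congr 1
      push_cast
      ring
    rw [term_of_ne_zero hn, cpow_add _ _ hn0, hnσ, hu2]
    field_simp
  rw [h1, h2, h3, show (3 : ℂ) * ((r : ℂ)⁻¹ * lCoeffP psi0 n) + 4 * ((r : ℂ)⁻¹ * (lCoeffP ψ n * u)) +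
      (r : ℂ)⁻¹ * (lCoeffP (psiSq ψ) n * u ^ 2) =
      (r : ℂ)⁻¹ * (3 * lCoeffP psi0 n + 4 * (lCoeffP ψ n * u) + lCoeffP (psiSq ψ) n * u ^ 2) by ring,
    ← Complex.ofReal_inv, re_ofReal_mul]
  refine mul_nonneg (inv_nonneg.mpr hr0.le) ?_
  have hexp : 3 * lCoeffP psi0 n + 4 * (lCoeffP ψ n * u) + lCoeffP (psiSq ψ) n * u ^ 2 =
      ∑ p ∈ pairsNormP n, ((Real.log (p.1.norm : ℝ) : ℝ) : ℂ) *
        (3 + 4 * (ψ p.1 ^ p.2 * u) + (ψ p.1 ^ p.2 * u) ^ 2) := by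
    simp only [lCoeffP, psi0, psiSq, mul_sum, sum_mul, ← sum_add_distrib]
    refine sum_congr rfl fun p _ ↦ ?_
    rw [one_pow, ← pow_mul, mul_comm 2 p.2, pow_mul]
    ring
  rw [hexp, re_sum]
  refine sum_nonneg fun p hp ↦ ?_
  obtain ⟨hπ, hj, -⟩ := mem_pairsNormP.mp hp
  obtain ⟨hP, hQ, -⟩ := mem_primesP.mp hπ
  have hN1 : (1 : ℝ) ≤ (p.1.norm : ℝ) := by
    have := GaussianHecke.two_le_norm_of_prime hP
    have h1 : (1 : ℤ) ≤ p.1.norm := by omega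
    exact_mod_cast h1
  rw [re_ofReal_mul]
  refine mul_nonneg (Real.log_nonneg hN1) ?_
  rcases hun p.1 hQ with h0 | h1'
  · rw [h0, zero_pow (by have := (mem_Icc.mp hj).1; omega), zero_mul]
    norm_num
  · refine GaussianHecke.re_three_add_nonneg ?_
    rw [norm_mul, norm_pow, h1', one_pow, one_mul, hnu]

/-- **`3 Re L(Λ₀, σ) + 4 Re L(l_ψ, σ+it) + Re L(l_{ψ²}, σ+2it) ≥ 0` for `σ > 1`** (field `three_four_one`).
[cite: MontgomeryVaughan2007, Lemma 6.5] -/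
theorem three_four_one {ψ : ℤ[i] → ℂ} (hbd : ∀ z, IsPrimary z → ‖ψ z‖ ≤ 1)
    (hun : ∀ z, IsPrimary z → ψ z = 0 ∨ ‖ψ z‖ = 1) {σ : ℝ} (hσ : 1 < σ) (t : ℝ) :
    0 ≤ 3 * (LSeries (fun n ↦ ((Lam0 n : ℝ) : ℂ)) σ).re + 4 * (LSeries (lCoeffP ψ) (σ + t * I)).re +
      (LSeries (lCoeffP (psiSq ψ)) (σ + 2 * t * I)).re := by
  have hbd2 : ∀ z, IsPrimary z → ‖psiSq ψ z‖ ≤ 1 := fun z hz ↦ by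
    rw [psiSq, norm_pow]; exact pow_le_one₀ (norm_nonneg _) (hbd z hz)
  have hs1 : 1 < (σ : ℂ).re := by rwa [ofReal_re]
  have hs2 : 1 < ((σ : ℂ) + t * I).re := by
    rwa [add_re, ofReal_re, mul_re, ofReal_re, ofReal_im, I_re, I_im, mul_zero, zero_mul,
      sub_zero, add_zero]
  have hs3 : 1 < ((σ : ℂ) + 2 * t * I).re := by
    rw [show (2 : ℂ) * t * I = ((2 * t : ℝ) : ℂ) * I by push_cast; ring]
    rwa [add_re, ofReal_re, mul_re, ofReal_re, ofReal_im, I_re, I_im, mul_zero, zero_mul,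
      sub_zero, add_zero]
  have hsum : HasSum (fun n ↦ 3 * term (fun n ↦ ((Lam0 n : ℝ) : ℂ)) σ n + 4 * term (lCoeffP ψ) (σ + t * I) n +
      term (lCoeffP (psiSq ψ)) (σ + 2 * t * I) n)
      (3 * LSeries (fun n ↦ ((Lam0 n : ℝ) : ℂ)) σ + 4 * LSeries (lCoeffP ψ) (σ + t * I) +
        LSeries (lCoeffP (psiSq ψ)) (σ + 2 * t * I)) :=
    (((LSeriesSummable_Lam0 hs1).hasSum.mul_left 3).add
      ((LSeriesSummable_lCoeffP hbd hs2).hasSum.mul_left 4)).add (LSeriesSummable_lCoeffP hbd2 hs3).hasSum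
  have key : 0 ≤ (3 * LSeries (fun n ↦ ((Lam0 n : ℝ) : ℂ)) σ + 4 * LSeries (lCoeffP ψ) (σ + t * I) +
      LSeries (lCoeffP (psiSq ψ)) (σ + 2 * t * I)).re := by
    rw [← hsum.tsum_eq, Complex.re_tsum hsum.summable]
    exact tsum_nonneg fun n ↦ re_term_341_nonneg hun σ t n
  simpa [add_re, mul_re] using key

end GaussianCosetTheta

end Literature.NumberTheory.LFunctions
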